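import Literature.Probability.FitznerVanDerHofstad2017.NobleBoundsNResidualB
import Literature.Probability.FitznerVanDerHofstad2017.NobleBoundsNResidualDoublePrime
import HarnessLib

/-!
# (5.34) at `N = M + 2` with the product-form row `(1, ≥2 | d ≥ 2)`, modulo the six coincidence slots — terminal family `Ā''`

[FvdH17] = R. Fitzner, R. van der Hofstad, *Mean-field behavior for nearest-neighbor percolation in `d > 10`*,
Electron. J. Probab. **22** (2017), no. 43, arXiv:1506.07977v2; §5.1 (5.4), Prop. 5.5 (5.34), §6.1 (6.4)–(6.10) and
"Case `a = 0, b ≥ 2`" (p. 59), App. B Table `B^{(2),ι,a,b}`.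

`''`-twin of §C–§F of `NobleBoundsNResidualB` (the (β′) regular targets `tgtRegB` / `tgtJB` / `tgtAllB`, their column
bounds and the (β′) first/middle dispatchers `nonempty_jPkg_first_regB` / `nonempty_jPkg_mid_regB` are those of the landed
module BY NAME — they never see `Ā`): `pkg` at every junction (`nonempty_jPkg_allB''`, last junction by
`NobleBoundsNEndDoublePrime.nonempty_jPkg_end_starA''`), the class estimate
(`prod_bondJ_mul_piPerc_jwCover_le_secStarB_of_pairPackages''`), (5.34) from a cover against the (β′) block with terminal
tables on `Ā'' = blockAbar''` (`tsum_nobleXiT_le_secStarB'_of_cover''`, translation invariance `isTransInv_blockAbar''`), at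
`N = M + 2` from per-pair packages (`tsum_nobleXiT_le_secStarB'_of_pairPackages''`) and from the six coincidence slots
(`nonempty_jPkg_all_of_residualsB''`, `tsum_nobleXiT_le_secStarB'_of_residuals''`).  Row `(0,2)` of `Ā''` is the repulsive
`𝓣_{1,1̲,0}` of §6.1 p. 59 (`NobleBlocksDoublePrime`); every other row `= Ā'`.  Nothing is cited as fact; additive; `d`-generic.
-/

noncomputable section

open scoped ENNReal

namespace Literature.Probability.FitznerVanDerHofstad2017

open Literature.Barriers.CriticalPhenomena Literature.Probability.Percolation
open Literature.Probability.LatticeModels Literature.Combinatorics.SimpleGraph _root_.SimpleGraph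
open _root_.MeasureTheory
open Literature.Probability.FitznerVanDerHofstad2017.NobleBlocks
open Literature.Probability.FitznerVanDerHofstad2017.NobleBlocks.LenIdx
open Literature.Probability.FitznerVanDerHofstad2017.BlockSummation

variable {d : ℕ}

/-! ### C. `pkg` at every junction from per-pair packages, (β′) targets -/

section Packages

variable (p : unitInterval) (M : ℕ) (x : Site d) (b : Fin (M + 2) → Site d × Site d) (w t z : Fin (M + 2) → Site d)
  (a : Fin (M + 2) → Fin 3 ⊕ Unit) (c : Fin 3 ⊕ Unit) (τ : Fin (M + 1) → Bool × Fin 3)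

/-- **`pkg` from per-pair packages, (β′) targets**: `NobleBoundsNDispatchAll.nonempty_jPkg_all` with `tgtRegB` in the
two regular-pair families (`hFR`, `hMR`); the regular/`★`, `★★`, closed-first-level and last-junction cases are the
landed ones.
[cite: FitznerVanDerHofstad2017, §6.1 (6.4) and "Case b = 0 / 1 / ≥ 2" (arXiv:1506.07977v2 pp. 58–59); §5.1 (5.4) (p. 48); (4.57)–(4.64) (pp. 41–42)] -/
theorem nonempty_jPkg_allB'' (κ : Fin (M + 2) → Fin d × Bool) (hκ : ∀ i, (b i).2 = (b i).1 + stepVec (κ i))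
    (hτ : AdmT M a τ)
    (hFR : ∀ a₀ a' : Fin 3, a (0 : Fin (M + 1)).castSucc = Sum.inl a₀ → a (0 : Fin (M + 1)).succ = Sum.inl a' →
      Nonempty (JPkg p (jctx M x b w t z a τ (0 : Fin (M + 1)).castSucc) (JFacts M x b w t z a c τ)
        (blockPS (Letters.perc d p) a₀ (b (0 : Fin (M + 1)).castSucc).1 (w (0 : Fin (M + 1)).castSucc) *
          tgtRegB (Letters.perc d p) (κ (0 : Fin (M + 1)).castSucc) a₀ a' (b (0 : Fin (M + 1)).castSucc).1
            (w (0 : Fin (M + 1)).castSucc) (t (0 : Fin (M + 1)).castSucc) (z (0 : Fin (M + 1)).castSucc)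
            (w (0 : Fin (M + 1)).succ) (b (0 : Fin (M + 1)).succ).1 (τ 0))))
    (hMR : ∀ i i₀ : Fin (M + 1), i₀.succ = i.castSucc → ∀ a₀ a' : Fin 3, a i.castSucc = Sum.inl a₀ →
      a i.succ = Sum.inl a' →
      Nonempty (JPkg p (jctx M x b w t z a τ i.castSucc) (JFacts M x b w t z a c τ)
        (tgtRegB (Letters.perc d p) (κ i.castSucc) a₀ a' (b i.castSucc).1 (w i.castSucc) (t i.castSucc) (z i.castSucc)
          (w i.succ) (b i.succ).1 (τ i))))
    (hML : ∀ i i₀ : Fin (M + 1), i₀.succ = i.castSucc → ∀ (u₀ : Unit) (a' : Fin 3), a i.castSucc = Sum.inr u₀ →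
      a i.succ = Sum.inl a' →
      Nonempty (JPkg p (jctx M x b w t z a τ i.castSucc) (JFacts M x b w t z a c τ)
        (tgtStarL (Letters.perc d p) (κ i.castSucc) a' (b i.castSucc).1 (w i.castSucc) (t i.castSucc) (z i.castSucc)
          (w i.succ) (b i.succ).1 (τ i)))) :
    ∀ k, Nonempty (JPkg p (jctx M x b w t z a τ k) (JFacts M x b w t z a c τ)
      (jTarget M (tgtAllB (Letters.perc d p) M a b w t z κ) (tgtLast'' (Letters.perc d p) M x a c b w t z κ) τ k)) := by
  intro k
  induction k using Fin.lastCases with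
  | last =>
      simp only [jTarget, Fin.lastCases_last]
      exact nonempty_jPkg_end_starA'' p M x b w t z a c τ (κ _) (hκ _)
  | cast i =>
      simp only [jTarget, Fin.lastCases_castSucc]
      -- the kind bit of a level below a closed one is `false` (admissibility)
      have hσ : ∀ u₁ : Unit, a i.succ = Sum.inr u₁ → (τ i).1 = false := fun u₁ h => hτ i (by rw [h]; rfl)
      rcases Fin.eq_zero_or_eq_succ i with rfl | ⟨j, rfl⟩
      · -- the FIRST junction
        rw [tgtAllB, if_pos rfl]
        rcases ha : a (0 : Fin (M + 1)).castSucc with a₀ | u₀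
        · rcases ha' : a (0 : Fin (M + 1)).succ with a' | u₁
          · rw [starS_inl, tgtJB_inl_inl]
            exact hFR a₀ a' ha ha'
          · rw [starS_inl, tgtJB_inl_inr]
            exact nonempty_jPkg_first_starU p M x b w t z a c τ (κ _) (hκ _) a₀ ha ha' (hσ u₁ ha')
        · exact nonempty_jPkg_of_closed_zero p M x b w t z a c τ ha _ _
      · -- a MIDDLE junction `k = j + 1`
        rw [tgtAllB, if_neg (Fin.succ_ne_zero j), one_mul]
        have hk : (j.castSucc).succ = (j.succ).castSucc := Fin.succ_castSucc j
        rcases ha : a j.succ.castSucc with a₀ | u₀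
        · rcases ha' : a j.succ.succ with a' | u₁
          · rw [tgtJB_inl_inl]
            exact hMR _ _ hk a₀ a' ha ha'
          · rw [tgtJB_inl_inr]
            exact nonempty_jPkg_mid_starU p M x b w t z a c τ _ _ hk (κ _) (hκ _) a₀ ha ha' (hσ u₁ ha')
        · rcases ha' : a j.succ.succ with a' | u₁
          · rw [tgtJB_inr_inl]
            exact hML _ _ hk u₀ a' ha ha'
          · rw [tgtJB_inr_inr]
            by_cases hs : z j.succ.castSucc = w j.succ.castSucc ∧ w j.succ.succ = (b j.succ.castSucc).1
            · exact nonempty_jPkg_mid_starStar p M x b w t z a c τ _ _ hk (κ _) (hκ _) ha ha' hs.1 hs.2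
            · exact nonempty_jPkg_starStar_of_ne p M x b w t z a c τ _ _ hk ha ha' (not_and_or.mp hs) _

end Packages

/-! ### D. The class estimate `h2` over `secStarBpt (blockBFullptB' (Letters.perc d p) X) 2 0` from per-pair packages -/

section ClassEstimate

variable (p : unitInterval) (M : ℕ) (x : Site d)

/-- **THE CLASS ESTIMATE `h2` FROM PER-PAIR JUNCTION PACKAGES, (β′) targets**: at `(a, c, b⃗, w⃗, t⃗, z⃗)`, packages
for the first regular pair and the middle regular pairs against `tgtRegB`, and for the middle lower-`★` pairs — for
every direction vector and admissible variant — give `(∏_i J(b_i)) · ℙ^{⊗(M+3)}(E ∩ C(a,c)) ≤ Σ_κ 𝟙{b = (u, u + e_κ)} ·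
starS(P^S)^{a_0}(u_0,w_0) · chainTail (secStarBpt (blockBFullptB' 𝐋 X) 2 0) (starA Ā'' (secEA Ā'' 2)) (starS P^E)`.
[cite: FitznerVanDerHofstad2017, §6.1 (6.4) pp. 58–59, §6.2.1 (6.48)–(6.51) pp. 65–67, §5.1 (5.4) p. 48, App. B pp. 74–78 (arXiv:1506.07977v2)] -/
theorem prod_bondJ_mul_piPerc_jwCover_le_secStarB_of_pairPackages'' (X : DirBlockFamilyPt d)
    (a : Fin (M + 2) → Fin 3 ⊕ Unit) (c : Fin 3 ⊕ Unit) (b : Fin (M + 2) → Site d × Site d)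
    (w t z : Fin (M + 2) → Site d)
    (hFR : ∀ κ : Fin (M + 2) → Fin d × Bool, (∀ i, (b i).2 = (b i).1 + stepVec (κ i)) →
      ∀ τ : Fin (M + 1) → Bool × Fin 3, AdmT M a τ →
      ∀ a₀ a' : Fin 3, a (0 : Fin (M + 1)).castSucc = Sum.inl a₀ → a (0 : Fin (M + 1)).succ = Sum.inl a' →
      Nonempty (JPkg p (jctx M x b w t z a τ (0 : Fin (M + 1)).castSucc) (JFacts M x b w t z a c τ)
        (blockPS (Letters.perc d p) a₀ (b (0 : Fin (M + 1)).castSucc).1 (w (0 : Fin (M + 1)).castSucc) *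
          tgtRegB (Letters.perc d p) (κ (0 : Fin (M + 1)).castSucc) a₀ a' (b (0 : Fin (M + 1)).castSucc).1
            (w (0 : Fin (M + 1)).castSucc) (t (0 : Fin (M + 1)).castSucc) (z (0 : Fin (M + 1)).castSucc)
            (w (0 : Fin (M + 1)).succ) (b (0 : Fin (M + 1)).succ).1 (τ 0))))
    (hMR : ∀ κ : Fin (M + 2) → Fin d × Bool, (∀ i, (b i).2 = (b i).1 + stepVec (κ i)) →
      ∀ τ : Fin (M + 1) → Bool × Fin 3, AdmT M a τ →
      ∀ i i₀ : Fin (M + 1), i₀.succ = i.castSucc → ∀ a₀ a' : Fin 3, a i.castSucc = Sum.inl a₀ →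
      a i.succ = Sum.inl a' →
      Nonempty (JPkg p (jctx M x b w t z a τ i.castSucc) (JFacts M x b w t z a c τ)
        (tgtRegB (Letters.perc d p) (κ i.castSucc) a₀ a' (b i.castSucc).1 (w i.castSucc) (t i.castSucc) (z i.castSucc)
          (w i.succ) (b i.succ).1 (τ i))))
    (hML : ∀ κ : Fin (M + 2) → Fin d × Bool, (∀ i, (b i).2 = (b i).1 + stepVec (κ i)) →
      ∀ τ : Fin (M + 1) → Bool × Fin 3, AdmT M a τ →
      ∀ i i₀ : Fin (M + 1), i₀.succ = i.castSucc → ∀ (u₀ : Unit) (a' : Fin 3), a i.castSucc = Sum.inr u₀ →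
      a i.succ = Sum.inl a' →
      Nonempty (JPkg p (jctx M x b w t z a τ i.castSucc) (JFacts M x b w t z a c τ)
        (tgtStarL (Letters.perc d p) (κ i.castSucc) a' (b i.castSucc).1 (w i.castSucc) (t i.castSucc) (z i.castSucc)
          (w i.succ) (b i.succ).1 (τ i)))) :
    (∏ i, ENNReal.ofReal (bondJ d p ((b i).2 - (b i).1))) *
        piPerc d p (M + 3) (jwCoverE M x b w t z ∩ jwCoverC M x b w t z a c) ≤
      ∑ κ : Fin (M + 2) → Fin d × Bool, dirInd stepVec κ b *
        (starS (blockPS (Letters.perc d p)) (a 0) (b 0).1 (w 0) *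
          chainTail (secStarBpt (blockBFullptB' (Letters.perc d p) X) 2 0)
            (starA (blockAbar'' (Letters.perc d p)) (secEA (blockAbar'' (Letters.perc d p)) 2))
            (starS (blockPE (Letters.perc d p))) x (M + 1) κ a c b w t z) :=
  prod_bondJ_mul_piPerc_jwCover_le_chain_of_packages p M x (starS (blockPS (Letters.perc d p)))
    (secStarBpt (blockBFullptB' (Letters.perc d p) X) 2 0)
    (starA (blockAbar'' (Letters.perc d p)) (secEA (blockAbar'' (Letters.perc d p)) 2)) (starS (blockPE (Letters.perc d p)))
    a c b w t z (tgtAllB (Letters.perc d p) M a b w t z) (tgtLast'' (Letters.perc d p) M x a c b w t z)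
    (fun κ hκ τ hτ => nonempty_jPkg_allB'' p M x b w t z a c τ κ hκ hτ (hFR κ hκ τ hτ) (hMR κ hκ τ hτ) (hML κ hκ τ hτ))
    (fun κ _ i => sum_filter_tgtAllB_le (Letters.perc d p) M a b w t z κ X i) fun _ _ => le_rfl

end ClassEstimate

/-! ### E. (5.34) against the (β′) block: from a cover, and at `N = M + 2` from per-pair packages -/

section SizeModel

open scoped Matrix

variable (p : unitInterval)

/-- **(5.34) at `N = n + 1` over `Fin 3 ⊕ Unit` under the section choice, (β′) block**: from a finite cover
`(E, C)` of the bounding events with `h1` and pointwise class estimates `h2` against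
`secStarBpt (blockBFullptB' 𝐋 X) 2 0` and `starA (blockAbar'' 𝐋) (secEA (blockAbar'' 𝐋) 2)`, for every four-line
remainder family `X` summing to a translation-invariant `X₂`, the printed-norm bound with the regular block
`starB (blockBFullB' 𝐋 X₂) (secEc (blockBFullpt' 𝐋 X) 0) (secEo (blockBFullpt' 𝐋 X) 2) (secEoc (blockBFullpt' 𝐋 X) 2 0)`
(the `★` families of the (β′) block are the landed ones).  The (β′) copy of
`NobleBoundsNCoverPrime.tsum_nobleXiT_le_secStar'_of_cover`, over `NobleBoundsNCover.nobleXiT_le_recP_chain_of_cover`.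
[cite: FitznerVanDerHofstad2017, Prop. 5.5 (5.34) (arXiv:1506.07977v2 p. 53); §5.1 (5.4), "Elements of the bounds" (pp. 48–49); Lemma 6.1 and §6.2.1 (6.48)–(6.51) (pp. 65–67); §6.1 (6.4)–(6.5) (p. 58)] -/
theorem tsum_nobleXiT_le_secStarB'_of_cover'' (n : ℕ)
    (X : DirBlockFamilyPt d) (X₂ : DirBlockFamily d)
    (hXsum : ∀ κ a a' u w w' u', ∑' t, ∑' z, X κ a a' u w t z w' u' = X₂ κ a a' u w w' u')
    (hX₂ti : ∀ ι a b, IsTransInv (X₂ ι a b))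
    (hXti : ∀ κ a a', IsTransInv₆ (X κ a a'))
    (E : Site d → (Fin (n + 1) → Site d × Site d) → (Fin (n + 1) → Site d) → (Fin (n + 1) → Site d) →
      (Fin (n + 1) → Site d) → Set (Fin (n + 2) → BondConfig (Site d)))
    (C : Site d → (Fin (n + 1) → Site d × Site d) → (Fin (n + 1) → Site d) → (Fin (n + 1) → Site d) →
      (Fin (n + 1) → Site d) → (Fin (n + 1) → Fin 3 ⊕ Unit) → Fin 3 ⊕ Unit → Set (Fin (n + 2) → BondConfig (Site d)))
    (hC : ∀ x b w t z, E x b w t z ⊆ ⋃ a, ⋃ c, C x b w t z a c)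
    (h1 : ∀ x, nobleXiT d p (n + 1) x ≤ ∑' b : Fin (n + 1) → Site d × Site d, ∑' w : Fin (n + 1) → Site d,
      ∑' t : Fin (n + 1) → Site d, ∑' z : Fin (n + 1) → Site d,
        (∏ i, ENNReal.ofReal (bondJ d p ((b i).2 - (b i).1))) * piPerc d p (n + 2) (E x b w t z))
    (h2 : ∀ x (a : Fin (n + 1) → Fin 3 ⊕ Unit) (c : Fin 3 ⊕ Unit) (b : Fin (n + 1) → Site d × Site d)
      (w t z : Fin (n + 1) → Site d),
      (∏ i, ENNReal.ofReal (bondJ d p ((b i).2 - (b i).1))) * piPerc d p (n + 2) (E x b w t z ∩ C x b w t z a c) ≤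
        ∑ κ : Fin (n + 1) → Fin d × Bool, dirInd stepVec κ b *
          (starS (blockPS (Letters.perc d p)) (a 0) (b 0).1 (w 0) *
            chainTail (secStarBpt (blockBFullptB' (Letters.perc d p) X) 2 0)
              (starA (blockAbar'' (Letters.perc d p)) (secEA (blockAbar'' (Letters.perc d p)) 2))
              (starS (blockPE (Letters.perc d p))) x n κ a c b w t z)) :
    ∑' x, nobleXiT d p (n + 1) x ≤
      vecP (starS (blockPS (Letters.perc d p))) ᵥ*
        matB (starB (blockBFullB' (Letters.perc d p) X₂) (secEc (blockBFullpt' (Letters.perc d p) X) 0)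
          (secEo (blockBFullpt' (Letters.perc d p) X) 2) (secEoc (blockBFullpt' (Letters.perc d p) X) 2 0)) ^ n ᵥ*
          matAbar (starA (blockAbar'' (Letters.perc d p)) (secEA (blockAbar'' (Letters.perc d p)) 2)) ⬝ᵥ
        vecP (starS (blockPE (Letters.perc d p))) :=
  tsum_le_vecMul_pow_dotProduct'
    (isTransInv_starB (isTransInv_blockBFullB' (Letters.perc d p) hX₂ti)
      (isTransInv₃_secEc (isTransInv₆_blockBFullpt' (Letters.perc d p) hXti) 0)
      (isTransInv_secEo (isTransInv₆_blockBFullpt' (Letters.perc d p) hXti) 2)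
      (isTransInv₃_secEoc (isTransInv₆_blockBFullpt' (Letters.perc d p) hXti) 2 0))
    (isTransInv_starA (isTransInv_blockAbar'' (Letters.perc d p)) (isTransInv₃_secEA (isTransInv_blockAbar'' (Letters.perc d p)) 2))
    (fun x => nobleXiT d p (n + 1) x) (starS (blockPS (Letters.perc d p))) (starS (blockPE (Letters.perc d p))) n
    fun x =>
    nobleXiT_le_recP_chain_of_cover p x n (starS (blockPS (Letters.perc d p)))
      (starB (blockBFullB' (Letters.perc d p) X₂) (secEc (blockBFullpt' (Letters.perc d p) X) 0)
        (secEo (blockBFullpt' (Letters.perc d p) X) 2) (secEoc (blockBFullpt' (Letters.perc d p) X) 2 0))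
      (secStarBpt (blockBFullptB' (Letters.perc d p) X) 2 0)
      (secStarBpt_blockBFullptB'_hBpt (Letters.perc d p) X X₂ hXsum)
      (starA (blockAbar'' (Letters.perc d p)) (secEA (blockAbar'' (Letters.perc d p)) 2)) (starS (blockPE (Letters.perc d p)))
      (E x) (C x) (hC x) (h1 x) (h2 x)

variable (M : ℕ)

/-- **(5.34) AT `N = M + 2` FROM PER-PAIR JUNCTION PACKAGES, (β′) targets** (section choice, the cover of
`NobleJointNLevel`): if at every `(x, a, c, b⃗, w⃗, t⃗, z⃗)` the three per-pair package families of
`prod_bondJ_mul_piPerc_jwCover_le_secStarB_of_pairPackages''` are available, then for every four-line remainder family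
`X` summing to a translation-invariant `X₂`,
`Σ_x Ξ̂^{(M+2)}(x) ≤ (P^S)ᵗ · B_sec^{M+1} · Ā_sec · P^E` over `Fin 3 ⊕ Unit` with the regular block `blockBFullB' 𝐋 X₂`.
[cite: FitznerVanDerHofstad2017, Prop. 5.5 (5.34) (arXiv:1506.07977v2 p. 53); §5.1 (5.4) (p. 48) and "Elements of the bounds" (p. 49); §6.1 (6.4) (pp. 58–59); Lemma 6.1, §6.2.1 (6.48)–(6.51) (pp. 65–67)] -/
theorem tsum_nobleXiT_le_secStarB'_of_pairPackages'' (X : DirBlockFamilyPt d) (X₂ : DirBlockFamily d)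
    (hXsum : ∀ κ a a' u w w' u', ∑' t, ∑' z, X κ a a' u w t z w' u' = X₂ κ a a' u w w' u')
    (hX₂ti : ∀ ι a b, IsTransInv (X₂ ι a b)) (hXti : ∀ κ a a', IsTransInv₆ (X κ a a'))
    (hFR : ∀ (x : Site d) (a : Fin (M + 2) → Fin 3 ⊕ Unit) (c : Fin 3 ⊕ Unit) (b : Fin (M + 2) → Site d × Site d)
      (w t z : Fin (M + 2) → Site d),
      ∀ κ : Fin (M + 2) → Fin d × Bool, (∀ i, (b i).2 = (b i).1 + stepVec (κ i)) →
      ∀ τ : Fin (M + 1) → Bool × Fin 3, AdmT M a τ →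
      ∀ a₀ a' : Fin 3, a (0 : Fin (M + 1)).castSucc = Sum.inl a₀ → a (0 : Fin (M + 1)).succ = Sum.inl a' →
      Nonempty (JPkg p (jctx M x b w t z a τ (0 : Fin (M + 1)).castSucc) (JFacts M x b w t z a c τ)
        (blockPS (Letters.perc d p) a₀ (b (0 : Fin (M + 1)).castSucc).1 (w (0 : Fin (M + 1)).castSucc) *
          tgtRegB (Letters.perc d p) (κ (0 : Fin (M + 1)).castSucc) a₀ a' (b (0 : Fin (M + 1)).castSucc).1
            (w (0 : Fin (M + 1)).castSucc) (t (0 : Fin (M + 1)).castSucc) (z (0 : Fin (M + 1)).castSucc)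
            (w (0 : Fin (M + 1)).succ) (b (0 : Fin (M + 1)).succ).1 (τ 0))))
    (hMR : ∀ (x : Site d) (a : Fin (M + 2) → Fin 3 ⊕ Unit) (c : Fin 3 ⊕ Unit) (b : Fin (M + 2) → Site d × Site d)
      (w t z : Fin (M + 2) → Site d),
      ∀ κ : Fin (M + 2) → Fin d × Bool, (∀ i, (b i).2 = (b i).1 + stepVec (κ i)) →
      ∀ τ : Fin (M + 1) → Bool × Fin 3, AdmT M a τ →
      ∀ i i₀ : Fin (M + 1), i₀.succ = i.castSucc → ∀ a₀ a' : Fin 3, a i.castSucc = Sum.inl a₀ →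
      a i.succ = Sum.inl a' →
      Nonempty (JPkg p (jctx M x b w t z a τ i.castSucc) (JFacts M x b w t z a c τ)
        (tgtRegB (Letters.perc d p) (κ i.castSucc) a₀ a' (b i.castSucc).1 (w i.castSucc) (t i.castSucc) (z i.castSucc)
          (w i.succ) (b i.succ).1 (τ i))))
    (hML : ∀ (x : Site d) (a : Fin (M + 2) → Fin 3 ⊕ Unit) (c : Fin 3 ⊕ Unit) (b : Fin (M + 2) → Site d × Site d)
      (w t z : Fin (M + 2) → Site d),
      ∀ κ : Fin (M + 2) → Fin d × Bool, (∀ i, (b i).2 = (b i).1 + stepVec (κ i)) →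
      ∀ τ : Fin (M + 1) → Bool × Fin 3, AdmT M a τ →
      ∀ i i₀ : Fin (M + 1), i₀.succ = i.castSucc → ∀ (u₀ : Unit) (a' : Fin 3), a i.castSucc = Sum.inr u₀ →
      a i.succ = Sum.inl a' →
      Nonempty (JPkg p (jctx M x b w t z a τ i.castSucc) (JFacts M x b w t z a c τ)
        (tgtStarL (Letters.perc d p) (κ i.castSucc) a' (b i.castSucc).1 (w i.castSucc) (t i.castSucc) (z i.castSucc)
          (w i.succ) (b i.succ).1 (τ i)))) :
    ∑' x, nobleXiT d p (M + 2) x ≤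
      vecP (starS (blockPS (Letters.perc d p))) ᵥ*
        matB (starB (blockBFullB' (Letters.perc d p) X₂) (secEc (blockBFullpt' (Letters.perc d p) X) 0)
          (secEo (blockBFullpt' (Letters.perc d p) X) 2) (secEoc (blockBFullpt' (Letters.perc d p) X) 2 0)) ^ (M + 1) ᵥ*
          matAbar (starA (blockAbar'' (Letters.perc d p)) (secEA (blockAbar'' (Letters.perc d p)) 2)) ⬝ᵥ
        vecP (starS (blockPE (Letters.perc d p))) :=
  tsum_nobleXiT_le_secStarB'_of_cover'' p (M + 1) X X₂ hXsum hX₂ti hXti (fun x b w t z => jwCoverE M x b w t z)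
    (fun x b w t z a c => jwCoverC M x b w t z a c) (fun x => jwCoverE_subset_iUnion_jwCoverC M x)
    (fun x => nobleXiT_succ_succ_le_jwCoverE p M x)
    fun x a c b w t z => prod_bondJ_mul_piPerc_jwCover_le_secStarB_of_pairPackages'' p M x X a c b w t z
      (hFR x a c b w t z) (hMR x a c b w t z) (hML x a c b w t z)

end SizeModel

/-! ### F. `pkg` and (5.34) at `N = M + 2` from the six coincidence slots -/

section Residual

open scoped Matrix

variable (p : unitInterval) (M : ℕ)

section Pkg

variable (x : Site d) (b : Fin (M + 2) → Site d × Site d) (w t z : Fin (M + 2) → Site d)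
  (a : Fin (M + 2) → Fin 3 ⊕ Unit) (c : Fin 3 ⊕ Unit) (τ : Fin (M + 1) → Bool × Fin 3)

/-- **`pkg` AT EVERY JUNCTION FROM THE SIX COINCIDENCE SLOTS, (β′) targets**: `nonempty_jPkg_allB''` with its three
per-pair families supplied by `nonempty_jPkg_first_regB`, `nonempty_jPkg_mid_regB` (§A) and the landed
`NobleBoundsNLowE.nonempty_jPkg_mid_starL'`.  What remains: R′ / R at the first pair (`hR'₀`, `hR₀`), at the middle
regular pairs (`hR'`, `hR`), and over a closed lower level at the middle lower-`★` pairs (`hR'L`, `hRL`).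
[cite: FitznerVanDerHofstad2017, §6.1 (6.4), "Case b = 0 / 1 / ≥ 2" and the coincidence cases `w' = t`, `z = t` (arXiv:1506.07977v2 pp. 58–59); App. B (pp. 75–76); §5.1 (5.4) (p. 48)] -/
theorem nonempty_jPkg_all_of_residualsB'' (κ : Fin (M + 2) → Fin d × Bool) (hκ : ∀ i, (b i).2 = (b i).1 + stepVec (κ i))
    (hτ : AdmT M a τ)
    (hR'₀ : ∀ a₀ a' : Fin 3, a (0 : Fin (M + 1)).castSucc = Sum.inl a₀ → a (0 : Fin (M + 1)).succ = Sum.inl a' →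
      (τ 0).1 = false → a' ≠ 0 → w (0 : Fin (M + 1)).succ = t (0 : Fin (M + 1)).castSucc →
      Nonempty (JPkg p (jctx M x b w t z a τ (0 : Fin (M + 1)).castSucc) (JFacts M x b w t z a c τ)
        (blockPS (Letters.perc d p) a₀ (b (0 : Fin (M + 1)).castSucc).1 (w (0 : Fin (M + 1)).castSucc) *
          tgtReg (Letters.perc d p) (κ (0 : Fin (M + 1)).castSucc) a₀ a' (b (0 : Fin (M + 1)).castSucc).1
            (w (0 : Fin (M + 1)).castSucc) (t (0 : Fin (M + 1)).castSucc) (z (0 : Fin (M + 1)).castSucc)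
            (w (0 : Fin (M + 1)).succ) (b (0 : Fin (M + 1)).succ).1 (τ 0))))
    (hR₀ : ∀ a₀ a' : Fin 3, a (0 : Fin (M + 1)).castSucc = Sum.inl a₀ → a (0 : Fin (M + 1)).succ = Sum.inl a' →
      τ 0 = (true, 0) → a' = 2 → t (0 : Fin (M + 1)).castSucc ≠ (b (0 : Fin (M + 1)).succ).1 →
      z (0 : Fin (M + 1)).castSucc = t (0 : Fin (M + 1)).castSucc →
      (zdGraph d).Adj (w (0 : Fin (M + 1)).succ) (t (0 : Fin (M + 1)).castSucc) →
      Nonempty (JPkg p (jctx M x b w t z a τ (0 : Fin (M + 1)).castSucc) (JFacts M x b w t z a c τ)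
        (blockPS (Letters.perc d p) a₀ (b (0 : Fin (M + 1)).castSucc).1 (w (0 : Fin (M + 1)).castSucc) *
          tgtReg (Letters.perc d p) (κ (0 : Fin (M + 1)).castSucc) a₀ a' (b (0 : Fin (M + 1)).castSucc).1
            (w (0 : Fin (M + 1)).castSucc) (t (0 : Fin (M + 1)).castSucc) (z (0 : Fin (M + 1)).castSucc)
            (w (0 : Fin (M + 1)).succ) (b (0 : Fin (M + 1)).succ).1 (τ 0))))
    (hR' : ∀ i i₀ : Fin (M + 1), i₀.succ = i.castSucc → ∀ a₀ a' : Fin 3, a i.castSucc = Sum.inl a₀ →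
      a i.succ = Sum.inl a' → (τ i).1 = false → a' ≠ 0 → w i.succ = t i.castSucc →
      Nonempty (JPkg p (jctx M x b w t z a τ i.castSucc) (JFacts M x b w t z a c τ)
        (tgtReg (Letters.perc d p) (κ i.castSucc) a₀ a' (b i.castSucc).1 (w i.castSucc) (t i.castSucc) (z i.castSucc)
          (w i.succ) (b i.succ).1 (τ i))))
    (hR : ∀ i i₀ : Fin (M + 1), i₀.succ = i.castSucc → ∀ a₀ a' : Fin 3, a i.castSucc = Sum.inl a₀ →
      a i.succ = Sum.inl a' → τ i = (true, 0) → a' = 2 → t i.castSucc ≠ (b i.succ).1 →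
      z i.castSucc = t i.castSucc → (zdGraph d).Adj (w i.succ) (t i.castSucc) →
      Nonempty (JPkg p (jctx M x b w t z a τ i.castSucc) (JFacts M x b w t z a c τ)
        (tgtReg (Letters.perc d p) (κ i.castSucc) a₀ a' (b i.castSucc).1 (w i.castSucc) (t i.castSucc) (z i.castSucc)
          (w i.succ) (b i.succ).1 (τ i))))
    (hR'L : ∀ i i₀ : Fin (M + 1), i₀.succ = i.castSucc → ∀ (u₀ : Unit) (a' : Fin 3), a i.castSucc = Sum.inr u₀ →
      a i.succ = Sum.inl a' → (τ i).1 = false → a' ≠ 0 → w i.succ = t i.castSucc →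
      Nonempty (JPkg p (jctx M x b w t z a τ i.castSucc) (JFacts M x b w t z a c τ)
        (tgtStarL (Letters.perc d p) (κ i.castSucc) a' (b i.castSucc).1 (w i.castSucc) (t i.castSucc) (z i.castSucc)
          (w i.succ) (b i.succ).1 (τ i))))
    (hRL : ∀ i i₀ : Fin (M + 1), i₀.succ = i.castSucc → ∀ (u₀ : Unit) (a' : Fin 3), a i.castSucc = Sum.inr u₀ →
      a i.succ = Sum.inl a' → (τ i).1 = true → (τ i).2 = 0 → a' = 2 → t i.castSucc ≠ (b i.succ).1 →
      z i.castSucc = t i.castSucc → z i.castSucc = w i.castSucc → (zdGraph d).Adj (w i.succ) (t i.castSucc) →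
      Nonempty (JPkg p (jctx M x b w t z a τ i.castSucc) (JFacts M x b w t z a c τ)
        (tgtStarL (Letters.perc d p) (κ i.castSucc) a' (b i.castSucc).1 (w i.castSucc) (t i.castSucc) (z i.castSucc)
          (w i.succ) (b i.succ).1 (τ i)))) :
    ∀ k, Nonempty (JPkg p (jctx M x b w t z a τ k) (JFacts M x b w t z a c τ)
      (jTarget M (tgtAllB (Letters.perc d p) M a b w t z κ) (tgtLast'' (Letters.perc d p) M x a c b w t z κ) τ k)) :=
  nonempty_jPkg_allB'' p M x b w t z a c τ κ hκ hτ
    (fun a₀ a' ha ha' => nonempty_jPkg_first_regB p M x b w t z a c τ (κ _) (hκ _) a₀ a' ha ha'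
      (hR'₀ a₀ a' ha ha') (hR₀ a₀ a' ha ha'))
    (fun i i₀ hk a₀ a' ha ha' => nonempty_jPkg_mid_regB p M x b w t z a c τ i i₀ hk (κ _) (hκ _) a₀ a' ha ha'
      (hR' i i₀ hk a₀ a' ha ha') (hR i i₀ hk a₀ a' ha ha'))
    fun i i₀ hk u₀ a' ha ha' => nonempty_jPkg_mid_starL' p M x b w t z a c τ i i₀ hk (κ _) (hκ _) ha a' ha'
      (hR'L i i₀ hk u₀ a' ha ha') (hRL i i₀ hk u₀ a' ha ha')

end Pkg

/-- **(5.34) AT `N = M + 2` MODULO THE SIX COINCIDENCE SLOTS, (β′) block** (section choice): for every four-line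
remainder family `X` summing to a translation-invariant `X₂`,
`Σ_x Ξ̂^{(M+2)}(x) ≤ (P^S)ᵗ · B_sec^{M+1} · Ā_sec · P^E` over `Fin 3 ⊕ Unit` with the regular block
`starB (blockBFullB' 𝐋 X₂) (secEc (blockBFullpt' 𝐋 X) 0) (secEo (blockBFullpt' 𝐋 X) 2) (secEoc (blockBFullpt' 𝐋 X) 2 0)`,
granted the six coincidence slots of `nonempty_jPkg_all_of_residualsB''` at every `(x, a, c, b⃗, w⃗, t⃗, z⃗)`, every
direction assignment `κ` of the pivotal bonds and every admissible junction-type assignment `τ`.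
[cite: FitznerVanDerHofstad2017, Prop. 5.5 (5.34) (arXiv:1506.07977v2 p. 53); §5.1 (5.4) (p. 48) and "Elements of the bounds" (p. 49); §6.1 (6.4) (pp. 58–59); Lemma 6.1, §6.2.1 (6.48)–(6.51) (pp. 65–67); App. B Table "B^{(2),ι,a,b}" row a = 1, b ≥ 2 (p. 76)] -/
theorem tsum_nobleXiT_le_secStarB'_of_residuals'' (X : DirBlockFamilyPt d) (X₂ : DirBlockFamily d)
    (hXsum : ∀ κ a a' u w w' u', ∑' t, ∑' z, X κ a a' u w t z w' u' = X₂ κ a a' u w w' u')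
    (hX₂ti : ∀ ι a b, IsTransInv (X₂ ι a b)) (hXti : ∀ κ a a', IsTransInv₆ (X κ a a'))
    (hR'₀ : ∀ (x : Site d) (a : Fin (M + 2) → Fin 3 ⊕ Unit) (c : Fin 3 ⊕ Unit) (b : Fin (M + 2) → Site d × Site d)
      (w t z : Fin (M + 2) → Site d),
      ∀ κ : Fin (M + 2) → Fin d × Bool, (∀ i, (b i).2 = (b i).1 + stepVec (κ i)) →
      ∀ τ : Fin (M + 1) → Bool × Fin 3, AdmT M a τ →
      ∀ a₀ a' : Fin 3, a (0 : Fin (M + 1)).castSucc = Sum.inl a₀ → a (0 : Fin (M + 1)).succ = Sum.inl a' →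
      (τ 0).1 = false → a' ≠ 0 → w (0 : Fin (M + 1)).succ = t (0 : Fin (M + 1)).castSucc →
      Nonempty (JPkg p (jctx M x b w t z a τ (0 : Fin (M + 1)).castSucc) (JFacts M x b w t z a c τ)
        (blockPS (Letters.perc d p) a₀ (b (0 : Fin (M + 1)).castSucc).1 (w (0 : Fin (M + 1)).castSucc) *
          tgtReg (Letters.perc d p) (κ (0 : Fin (M + 1)).castSucc) a₀ a' (b (0 : Fin (M + 1)).castSucc).1
            (w (0 : Fin (M + 1)).castSucc) (t (0 : Fin (M + 1)).castSucc) (z (0 : Fin (M + 1)).castSucc)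
            (w (0 : Fin (M + 1)).succ) (b (0 : Fin (M + 1)).succ).1 (τ 0))))
    (hR₀ : ∀ (x : Site d) (a : Fin (M + 2) → Fin 3 ⊕ Unit) (c : Fin 3 ⊕ Unit) (b : Fin (M + 2) → Site d × Site d)
      (w t z : Fin (M + 2) → Site d),
      ∀ κ : Fin (M + 2) → Fin d × Bool, (∀ i, (b i).2 = (b i).1 + stepVec (κ i)) →
      ∀ τ : Fin (M + 1) → Bool × Fin 3, AdmT M a τ →
      ∀ a₀ a' : Fin 3, a (0 : Fin (M + 1)).castSucc = Sum.inl a₀ → a (0 : Fin (M + 1)).succ = Sum.inl a' →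
      τ 0 = (true, 0) → a' = 2 → t (0 : Fin (M + 1)).castSucc ≠ (b (0 : Fin (M + 1)).succ).1 →
      z (0 : Fin (M + 1)).castSucc = t (0 : Fin (M + 1)).castSucc →
      (zdGraph d).Adj (w (0 : Fin (M + 1)).succ) (t (0 : Fin (M + 1)).castSucc) →
      Nonempty (JPkg p (jctx M x b w t z a τ (0 : Fin (M + 1)).castSucc) (JFacts M x b w t z a c τ)
        (blockPS (Letters.perc d p) a₀ (b (0 : Fin (M + 1)).castSucc).1 (w (0 : Fin (M + 1)).castSucc) *
          tgtReg (Letters.perc d p) (κ (0 : Fin (M + 1)).castSucc) a₀ a' (b (0 : Fin (M + 1)).castSucc).1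
            (w (0 : Fin (M + 1)).castSucc) (t (0 : Fin (M + 1)).castSucc) (z (0 : Fin (M + 1)).castSucc)
            (w (0 : Fin (M + 1)).succ) (b (0 : Fin (M + 1)).succ).1 (τ 0))))
    (hR' : ∀ (x : Site d) (a : Fin (M + 2) → Fin 3 ⊕ Unit) (c : Fin 3 ⊕ Unit) (b : Fin (M + 2) → Site d × Site d)
      (w t z : Fin (M + 2) → Site d),
      ∀ κ : Fin (M + 2) → Fin d × Bool, (∀ i, (b i).2 = (b i).1 + stepVec (κ i)) →
      ∀ τ : Fin (M + 1) → Bool × Fin 3, AdmT M a τ →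
      ∀ i i₀ : Fin (M + 1), i₀.succ = i.castSucc → ∀ a₀ a' : Fin 3, a i.castSucc = Sum.inl a₀ →
      a i.succ = Sum.inl a' → (τ i).1 = false → a' ≠ 0 → w i.succ = t i.castSucc →
      Nonempty (JPkg p (jctx M x b w t z a τ i.castSucc) (JFacts M x b w t z a c τ)
        (tgtReg (Letters.perc d p) (κ i.castSucc) a₀ a' (b i.castSucc).1 (w i.castSucc) (t i.castSucc) (z i.castSucc)
          (w i.succ) (b i.succ).1 (τ i))))
    (hR : ∀ (x : Site d) (a : Fin (M + 2) → Fin 3 ⊕ Unit) (c : Fin 3 ⊕ Unit) (b : Fin (M + 2) → Site d × Site d)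
      (w t z : Fin (M + 2) → Site d),
      ∀ κ : Fin (M + 2) → Fin d × Bool, (∀ i, (b i).2 = (b i).1 + stepVec (κ i)) →
      ∀ τ : Fin (M + 1) → Bool × Fin 3, AdmT M a τ →
      ∀ i i₀ : Fin (M + 1), i₀.succ = i.castSucc → ∀ a₀ a' : Fin 3, a i.castSucc = Sum.inl a₀ →
      a i.succ = Sum.inl a' → τ i = (true, 0) → a' = 2 → t i.castSucc ≠ (b i.succ).1 →
      z i.castSucc = t i.castSucc → (zdGraph d).Adj (w i.succ) (t i.castSucc) →
      Nonempty (JPkg p (jctx M x b w t z a τ i.castSucc) (JFacts M x b w t z a c τ)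
        (tgtReg (Letters.perc d p) (κ i.castSucc) a₀ a' (b i.castSucc).1 (w i.castSucc) (t i.castSucc) (z i.castSucc)
          (w i.succ) (b i.succ).1 (τ i))))
    (hR'L : ∀ (x : Site d) (a : Fin (M + 2) → Fin 3 ⊕ Unit) (c : Fin 3 ⊕ Unit) (b : Fin (M + 2) → Site d × Site d)
      (w t z : Fin (M + 2) → Site d),
      ∀ κ : Fin (M + 2) → Fin d × Bool, (∀ i, (b i).2 = (b i).1 + stepVec (κ i)) →
      ∀ τ : Fin (M + 1) → Bool × Fin 3, AdmT M a τ →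
      ∀ i i₀ : Fin (M + 1), i₀.succ = i.castSucc → ∀ (u₀ : Unit) (a' : Fin 3), a i.castSucc = Sum.inr u₀ →
      a i.succ = Sum.inl a' → (τ i).1 = false → a' ≠ 0 → w i.succ = t i.castSucc →
      Nonempty (JPkg p (jctx M x b w t z a τ i.castSucc) (JFacts M x b w t z a c τ)
        (tgtStarL (Letters.perc d p) (κ i.castSucc) a' (b i.castSucc).1 (w i.castSucc) (t i.castSucc) (z i.castSucc)
          (w i.succ) (b i.succ).1 (τ i))))
    (hRL : ∀ (x : Site d) (a : Fin (M + 2) → Fin 3 ⊕ Unit) (c : Fin 3 ⊕ Unit) (b : Fin (M + 2) → Site d × Site d)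
      (w t z : Fin (M + 2) → Site d),
      ∀ κ : Fin (M + 2) → Fin d × Bool, (∀ i, (b i).2 = (b i).1 + stepVec (κ i)) →
      ∀ τ : Fin (M + 1) → Bool × Fin 3, AdmT M a τ →
      ∀ i i₀ : Fin (M + 1), i₀.succ = i.castSucc → ∀ (u₀ : Unit) (a' : Fin 3), a i.castSucc = Sum.inr u₀ →
      a i.succ = Sum.inl a' → (τ i).1 = true → (τ i).2 = 0 → a' = 2 → t i.castSucc ≠ (b i.succ).1 →
      z i.castSucc = t i.castSucc → z i.castSucc = w i.castSucc → (zdGraph d).Adj (w i.succ) (t i.castSucc) →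
      Nonempty (JPkg p (jctx M x b w t z a τ i.castSucc) (JFacts M x b w t z a c τ)
        (tgtStarL (Letters.perc d p) (κ i.castSucc) a' (b i.castSucc).1 (w i.castSucc) (t i.castSucc) (z i.castSucc)
          (w i.succ) (b i.succ).1 (τ i)))) :
    ∑' x, nobleXiT d p (M + 2) x ≤
      vecP (starS (blockPS (Letters.perc d p))) ᵥ*
        matB (starB (blockBFullB' (Letters.perc d p) X₂) (secEc (blockBFullpt' (Letters.perc d p) X) 0)
          (secEo (blockBFullpt' (Letters.perc d p) X) 2) (secEoc (blockBFullpt' (Letters.perc d p) X) 2 0)) ^ (M + 1) ᵥ*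
          matAbar (starA (blockAbar'' (Letters.perc d p)) (secEA (blockAbar'' (Letters.perc d p)) 2)) ⬝ᵥ
        vecP (starS (blockPE (Letters.perc d p))) :=
  tsum_nobleXiT_le_secStarB'_of_pairPackages'' p M X X₂ hXsum hX₂ti hXti
    (fun x a c b w t z κ hκ τ hτ a₀ a' ha ha' => nonempty_jPkg_first_regB p M x b w t z a c τ (κ _) (hκ _) a₀ a' ha ha'
      (hR'₀ x a c b w t z κ hκ τ hτ a₀ a' ha ha') (hR₀ x a c b w t z κ hκ τ hτ a₀ a' ha ha'))
    (fun x a c b w t z κ hκ τ hτ i i₀ hk a₀ a' ha ha' => nonempty_jPkg_mid_regB p M x b w t z a c τ i i₀ hk (κ _) (hκ _)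
      a₀ a' ha ha' (hR' x a c b w t z κ hκ τ hτ i i₀ hk a₀ a' ha ha') (hR x a c b w t z κ hκ τ hτ i i₀ hk a₀ a' ha ha'))
    fun x a c b w t z κ hκ τ hτ i i₀ hk u₀ a' ha ha' => nonempty_jPkg_mid_starL' p M x b w t z a c τ i i₀ hk (κ _) (hκ _)
      ha a' ha' (hR'L x a c b w t z κ hκ τ hτ i i₀ hk u₀ a' ha ha') (hRL x a c b w t z κ hκ τ hτ i i₀ hk u₀ a' ha ha')

end Residual

end Literature.Probability.FitznerVanDerHofstad2017

end
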